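import Summits.Ventures.QEC.Thresholds.ToricCodeHGP
import Mathlib.Analysis.SpecificLimits.Normed
import HarnessLib

/-!
# Six UNCONDITIONAL certified thresholds for the toric codes AS HYPERGRAPH PRODUCTS `HGP(circ_L, circ_L)`
# (census cell B.0) through the generic HGP pipeline: `p₀(3)`, `1/3`, `p₀(5)`, both sectors

Venture QEC, `Summits/Ventures/QEC/Thresholds/` (LADDER-QEC rung Q5, cell Q5.hgp; qec-type-09 gen 3, item 09.HGPTH,
"one B.0 seed pair"). With the seed facts of `ToricCodeHGP.lean` (degrees `(2,2)`, `d(ker circ_L) = d(ker circ_Lᵀ)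
≥ L`, `k = 2`) the family theorems of `HypergraphProductFamilyThresholds.lean` apply to `toricHGPCode k =
HGP.code (cycMatrix k) (cycMatrix k)` with `w = 2 + 2 = 4` in both sectors, and the growth hypothesis is PROVED
here (`toricHGP_growth`: `2L²·r^L → 0`; `toricHGP_phenom_growth`: `3L²·T(L)·r^L → 0` for polynomially bounded `T`):

| noise model (per sector, every minimum-weight (space-time) decoder family) | certified lower bound | theorems |
|---|---|---|
| code capacity | `p₀(3) = (3-2√2)/6`, `> .0285` | `toricHGP_z|x_isThresholdLowerBound`, `toricHGP_z_accuracyThreshold_gt` |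
| erasure | `1/3` | `toricHGP_z|x_erasure_isThresholdLowerBound` |
| phenomenological `q = p`, `T(L)` polynomial | `p₀(5) = (5-2√6)/10`, `> .0101` | `toricHGP_z|x_phenom_isThresholdLowerBound`, `toricHGP_z_phenom_accuracyThreshold_gt` |

plus the canonical instances (`…_minWeight`: minimum-weight decoding of the `X`-syndrome; `T(L) = k + 1` rounds with
minimum-weight space-time decoding).

HONEST FRAMING: UNCONDITIONAL, kernel axioms, no named fact, no `native_decide`. These are the SAME constants as the
cell's direct toric-code theorems (`ToricCodeThresholdUnconditional`, `ToricCodePhenomenologicalElementary`: `p₀(3)`,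
`p₀(5)`; the self-avoiding-walk route gives the better `.0322` / `.0106`) — the content of this file is the ROUTE:
the B.0 census objects pass through the generic hypergraph-product pipeline (degrees → check weights, seed distances
→ sector distances by TZ Thm 9, TZ Thm 7 for non-vacuity) with every hypothesis discharged: a cross-check of that
pipeline on a family whose answer is known, and the first HGP family of the cell with NO residual hypothesis.

## References

* [DumerKovalevPryadko2015] I. Dumer, A. A. Kovalev, L. P. Pryadko, PRL 115 (2015) 050502, Thms 2–3, p. 5
  (`y_c* = 1/3`, `p_Zc* ≈ .029` for the toric code; `w → w + 2`).
* [DennisEtAl2002] E. Dennis, A. Kitaev, A. Landahl, J. Preskill, J. Math. Phys. 43 (2002) 4452, §5.3.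
* [KovalevPryadko2012] A. A. Kovalev, L. P. Pryadko, arXiv:1202.0928, Examples 2 and 6.
-/

noncomputable section

namespace Summit.Ventures.QEC.Thresholds

open Filter Topology Finset Matrix
open Literature.InformationTheory.QuantumCodes
open Literature.InformationTheory.Coding (minDist)

/-! ### Growth of the family -/

/-- Polynomial size, linear distance: `A (k+2)^m r^{k+2} → 0` for `0 < r < 1`.
[cite: DennisEtAl2002, §5.3 (L² μ^L (4p̃)^{L/2} → 0)] -/
private theorem tendsto_poly_mul_pow {r : ℝ} (hr0 : 0 < r) (hr1 : r < 1) (A : ℝ) (m : ℕ) :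
    Tendsto (fun k : ℕ => A * ((k : ℝ) + 2) ^ m * r ^ (k + 2)) atTop (𝓝 0) := by
  have h0 := tendsto_pow_const_mul_const_pow_of_abs_lt_one m
    (show |r| < 1 by rwa [abs_of_nonneg hr0.le])
  have h1 : Tendsto (fun k : ℕ => ((k + 2 : ℕ) : ℝ) ^ m * r ^ (k + 2)) atTop (𝓝 0) :=
    (Filter.tendsto_add_atTop_iff_nat 2).2 h0
  have h2 := h1.const_mul A
  rw [mul_zero] at h2
  refine h2.congr fun k => ?_
  push_cast
  ring

/-- Code-capacity / erasure growth: `2L²·r^L → 0`. [cite: DennisEtAl2002, §5.3 (polynomial prefactor times exponential decay)] -/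
theorem toricHGP_growth {r : ℝ} (hr0 : 0 < r) (hr1 : r < 1) :
    Tendsto (fun k : ℕ => (((k + 2) * (k + 2) + (k + 2) * (k + 2) : ℕ) : ℝ) * r ^ (k + 2)) atTop (𝓝 0) := by
  refine (tendsto_poly_mul_pow hr0 hr1 2 2).congr fun k => ?_
  push_cast
  ring

/-- Phenomenological growth: `3L²·T(L)·r^L → 0` for polynomially bounded `T`.
[cite: DennisEtAl2002, §5.3 (with T increasing no faster than a polynomial of L)] -/
theorem toricHGP_phenom_growth {T : ℕ → ℕ} (hT : ToricCode.IsPolyBounded T) {r : ℝ} (hr0 : 0 < r) (hr1 : r < 1) :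
    Tendsto (fun k : ℕ =>
      ((((k + 2) * (k + 2) + (k + 2) * (k + 2) + (k + 2) * (k + 2)) * T k : ℕ) : ℝ) * r ^ (k + 2))
      atTop (𝓝 0) := by
  obtain ⟨A, m, hAm⟩ := hT
  have hA0 : 0 ≤ A := by
    have h := hAm 0
    simp only [Nat.cast_zero, zero_add, one_pow, mul_one] at h
    exact le_trans (Nat.cast_nonneg _) h
  have h := tendsto_poly_mul_pow hr0 hr1 (3 * A) (m + 2)
  refine squeeze_zero (fun k => by positivity) (fun k => ?_) h
  have hrk : 0 ≤ r ^ (k + 2) := pow_nonneg hr0.le _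
  have hk1 : ((k : ℝ) + 1) ^ m ≤ ((k : ℝ) + 2) ^ m :=
    pow_le_pow_left₀ (by positivity) (by linarith) m
  have hTk' : (T k : ℝ) ≤ A * ((k : ℝ) + 2) ^ m := (hAm k).trans (mul_le_mul_of_nonneg_left hk1 hA0)
  have hsize : ((((k + 2) * (k + 2) + (k + 2) * (k + 2) + (k + 2) * (k + 2)) * T k : ℕ) : ℝ) ≤
      3 * A * ((k : ℝ) + 2) ^ (m + 2) := by
    push_cast
    have hT0 : 0 ≤ (T k : ℝ) := Nat.cast_nonneg _
    calc (((k : ℝ) + 2) * ((k : ℝ) + 2) + ((k : ℝ) + 2) * ((k : ℝ) + 2) + ((k : ℝ) + 2) * ((k : ℝ) + 2)) *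
          (T k : ℝ) ≤ (3 * ((k : ℝ) + 2) ^ 2) * (A * ((k : ℝ) + 2) ^ m) :=
          mul_le_mul (le_of_eq (by ring)) hTk' hT0 (by positivity)
      _ = 3 * A * ((k : ℝ) + 2) ^ (m + 2) := by ring
  exact mul_le_mul_of_nonneg_right hsize hrk

/-! ### The six thresholds, unconditional -/

/-- **Code-capacity threshold `≥ p₀(3) = (3-2√2)/6 ≈ .0286`, `Z`-sector, toric codes as `HGP(circ_L, circ_L)`,
EVERY family of minimum-weight decoders.** UNCONDITIONAL. [cite: DumerKovalevPryadko2015, Thm 2 (y = 0, w = 4) and p. 5 (p_Zc* ≈ 0.029 for the toric code)] -/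
theorem toricHGP_z_isThresholdLowerBound
    (D : ∀ k, Decoder ((Fin (k + 2) × Fin (k + 2)) → ZMod 2)
      (((Fin (k + 2) × Fin (k + 2)) ⊕ (Fin (k + 2) × Fin (k + 2))) → ZMod 2))
    (hD : ∀ k, (D k).IsMinWeight (toricHGPCode k).zSyndrome ((toricHGPCode k).kerX : Set _) hammingNorm) :
    IsThresholdLowerBound (zFailureFamily (fun k => toricHGPCode k) D) (thresholdValue 3) := by
  have h := hgp_z_isThresholdLowerBound (fun k => cycMatrix k) (fun k => cycMatrix k) D hD (c₁ := 2) (q₂ := 2)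
    (by norm_num) (fun k => hammingNorm_cycMatrix_row_le k) (fun k => hammingNorm_cycMatrix_col_le k)
    (fun k => k + 2) (fun k => by omega) (fun k => le_minDist_pcCode_cycMatrix k)
    (fun k => le_minDist_pcCode_cycMatrix_transpose k) (fun r hr0 hr1 => toricHGP_growth hr0 hr1)
  norm_num at h
  exact h

/-- **Code-capacity threshold `≥ p₀(3)`, `X`-sector**, toric codes as hypergraph products, every minimum-weight
decoder family. UNCONDITIONAL. [cite: DumerKovalevPryadko2015, Thm 2 (y = 0, w = 4)] -/
theorem toricHGP_x_isThresholdLowerBound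
    (D : ∀ k, Decoder ((Fin (k + 2) × Fin (k + 2)) → ZMod 2)
      (((Fin (k + 2) × Fin (k + 2)) ⊕ (Fin (k + 2) × Fin (k + 2))) → ZMod 2))
    (hD : ∀ k, (D k).IsMinWeight (toricHGPCode k).xSyndrome ((toricHGPCode k).kerZ : Set _) hammingNorm) :
    IsThresholdLowerBound (xFailureFamily (fun k => toricHGPCode k) D) (thresholdValue 3) := by
  have h := hgp_x_isThresholdLowerBound (fun k => cycMatrix k) (fun k => cycMatrix k) D hD (q₁ := 2) (c₂ := 2)
    (by norm_num) (fun k => hammingNorm_cycMatrix_col_le k) (fun k => hammingNorm_cycMatrix_row_le k)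
    (fun k => k + 2) (fun k => by omega) (fun k => le_minDist_pcCode_cycMatrix_transpose k)
    (fun k => le_minDist_pcCode_cycMatrix k) (fun r hr0 hr1 => toricHGP_growth hr0 hr1)
  norm_num at h
  exact h

/-- **Erasure threshold `≥ 1/3`, `Z`-sector**, toric codes as hypergraph products. UNCONDITIONAL.
[cite: DumerKovalevPryadko2015, Thm 2 (erasure part) and p. 5 (y_c* = 1/3 for the toric code)] -/
theorem toricHGP_z_erasure_isThresholdLowerBound :
    IsThresholdLowerBound (zErasureFamily (fun k => toricHGPCode k)) (1 / 3) := by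
  have h := hgp_z_erasure_isThresholdLowerBound (fun k => cycMatrix k) (fun k => cycMatrix k) (c₁ := 2) (q₂ := 2)
    (by norm_num) (fun k => hammingNorm_cycMatrix_row_le k) (fun k => hammingNorm_cycMatrix_col_le k)
    (fun k => k + 2) (fun k => by omega) (fun k => le_minDist_pcCode_cycMatrix k)
    (fun k => le_minDist_pcCode_cycMatrix_transpose k) (fun r hr0 hr1 => toricHGP_growth hr0 hr1)
  norm_num at h
  exact h

/-- **Erasure threshold `≥ 1/3`, `X`-sector**, toric codes as hypergraph products. UNCONDITIONAL.
[cite: DumerKovalevPryadko2015, Thm 2 (erasure part) and p. 5 (y_c* = 1/3)] -/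
theorem toricHGP_x_erasure_isThresholdLowerBound :
    IsThresholdLowerBound (xErasureFamily (fun k => toricHGPCode k)) (1 / 3) := by
  have h := hgp_x_erasure_isThresholdLowerBound (fun k => cycMatrix k) (fun k => cycMatrix k) (q₁ := 2) (c₂ := 2)
    (by norm_num) (fun k => hammingNorm_cycMatrix_col_le k) (fun k => hammingNorm_cycMatrix_row_le k)
    (fun k => k + 2) (fun k => by omega) (fun k => le_minDist_pcCode_cycMatrix_transpose k)
    (fun k => le_minDist_pcCode_cycMatrix k) (fun r hr0 hr1 => toricHGP_growth hr0 hr1)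
  norm_num at h
  exact h

/-- **Phenomenological threshold `≥ p₀(5) = (5-2√6)/10 ≈ .0101`, `Z`-sector** (`q = p`, polynomially many noisy
rounds, EVERY family of minimum-weight space-time decoders), toric codes as hypergraph products. UNCONDITIONAL.
[cite: DumerKovalevPryadko2015, Thm 3 with p. 5 (w → w + 2)] [cite: DennisEtAl2002, §5.3 eq. (threshold_iso)] -/
theorem toricHGP_z_phenom_isThresholdLowerBound {T : ℕ → ℕ} (hT : ToricCode.IsPolyBounded T)
    (D : ∀ k, CSSPhenom.STDecoder (Fin (k + 2) × Fin (k + 2))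
      ((Fin (k + 2) × Fin (k + 2)) ⊕ (Fin (k + 2) × Fin (k + 2))) (T k))
    (hD : ∀ k, (D k).IsMinWeight (CSSPhenom.stSyn (toricHGPCode k).HX (T k))
      (CSSPhenom.stCycles (toricHGPCode k).HX (T k)) hammingNorm) :
    IsThresholdLowerBound (zPhenomFailureFamily (fun k => toricHGPCode k) T D) (thresholdValue 5) := by
  have h := hgp_z_phenom_isThresholdLowerBound (fun k => cycMatrix k) (fun k => cycMatrix k) T D hD
    (c₁ := 2) (q₂ := 2) (fun k => hammingNorm_cycMatrix_row_le k) (fun k => hammingNorm_cycMatrix_col_le k)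
    (fun k => k + 2) (fun k => by omega) (fun k => le_minDist_pcCode_cycMatrix k)
    (fun k => le_minDist_pcCode_cycMatrix_transpose k) (fun r hr0 hr1 => toricHGP_phenom_growth hT hr0 hr1)
  norm_num at h
  exact h

/-- **Phenomenological threshold `≥ p₀(5)`, `X`-sector** (`q = p`), toric codes as hypergraph products.
UNCONDITIONAL. [cite: DumerKovalevPryadko2015, Thm 3 with p. 5 (w → w + 2)] -/
theorem toricHGP_x_phenom_isThresholdLowerBound {T : ℕ → ℕ} (hT : ToricCode.IsPolyBounded T)
    (D : ∀ k, CSSPhenom.STDecoder (Fin (k + 2) × Fin (k + 2))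
      ((Fin (k + 2) × Fin (k + 2)) ⊕ (Fin (k + 2) × Fin (k + 2))) (T k))
    (hD : ∀ k, (D k).IsMinWeight (CSSPhenom.stSyn (toricHGPCode k).HZ (T k))
      (CSSPhenom.stCycles (toricHGPCode k).HZ (T k)) hammingNorm) :
    IsThresholdLowerBound (xPhenomFailureFamily (fun k => toricHGPCode k) T D) (thresholdValue 5) := by
  have h := hgp_x_phenom_isThresholdLowerBound (fun k => cycMatrix k) (fun k => cycMatrix k) T D hD
    (q₁ := 2) (c₂ := 2) (fun k => hammingNorm_cycMatrix_col_le k) (fun k => hammingNorm_cycMatrix_row_le k)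
    (fun k => k + 2) (fun k => by omega) (fun k => le_minDist_pcCode_cycMatrix_transpose k)
    (fun k => le_minDist_pcCode_cycMatrix k) (fun r hr0 hr1 => toricHGP_phenom_growth hT hr0 hr1)
  norm_num at h
  exact h

/-! ### Canonical instances and decimals -/

/-- Everything chosen canonically (minimum-weight decoding of the `X`-syndrome): threshold `≥ p₀(3)`.
[cite: DumerKovalevPryadko2015, p. 5 (p_Zc* ≈ 0.029)] -/
theorem toricHGP_z_isThresholdLowerBound_minWeight :
    IsThresholdLowerBound
      (zFailureFamily (fun k => toricHGPCode k) fun k => Decoder.minWeight (toricHGPCode k).zSyndrome hammingNorm)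
      (thresholdValue 3) :=
  toricHGP_z_isThresholdLowerBound _ fun k => (toricHGPCode k).isMinWeight_minWeight_zSyndrome

/-- Canonical phenomenological instance (`T(L) = k + 1` rounds, minimum-weight space-time decoding): threshold
`≥ p₀(5)`. [cite: DennisEtAl2002, §5.3 eq. (threshold_iso)] -/
theorem toricHGP_z_phenom_isThresholdLowerBound_minWeight :
    IsThresholdLowerBound
      (zPhenomFailureFamily (fun k => toricHGPCode k) (fun k => k + 1)
        fun k => Decoder.minWeight (CSSPhenom.stSyn (toricHGPCode k).HX (k + 1)) hammingNorm)
      (thresholdValue 5) :=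
  toricHGP_z_phenom_isThresholdLowerBound isPolyBounded_succ _ fun _ => CSSPhenom.isMinWeight_minWeight _ _

/-- **`p_c > .0285`** (decimal, `Z`-sector, code capacity) for the toric codes as hypergraph products.
[cite: DumerKovalevPryadko2015, p. 5 (p_Zc* ≈ 0.029)] -/
theorem toricHGP_z_accuracyThreshold_gt
    (D : ∀ k, Decoder ((Fin (k + 2) × Fin (k + 2)) → ZMod 2)
      (((Fin (k + 2) × Fin (k + 2)) ⊕ (Fin (k + 2) × Fin (k + 2))) → ZMod 2))
    (hD : ∀ k, (D k).IsMinWeight (toricHGPCode k).zSyndrome ((toricHGPCode k).kerX : Set _) hammingNorm) :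
    (0.0285 : ℝ) < accuracyThreshold (zFailureFamily (fun k => toricHGPCode k) D) :=
  lt_of_lt_of_le thresholdValue_three_bounds.1
    (le_accuracyThreshold (toricHGP_z_isThresholdLowerBound D hD) ((thresholdValue_le_half 3).trans (by norm_num)))

/-- **`p_c > .0101`** (decimal, `Z`-sector, phenomenological `q = p`) for the toric codes as hypergraph products.
[cite: DennisEtAl2002, §5.3 eq. (threshold_iso_num)] -/
theorem toricHGP_z_phenom_accuracyThreshold_gt {T : ℕ → ℕ} (hT : ToricCode.IsPolyBounded T)
    (D : ∀ k, CSSPhenom.STDecoder (Fin (k + 2) × Fin (k + 2))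
      ((Fin (k + 2) × Fin (k + 2)) ⊕ (Fin (k + 2) × Fin (k + 2))) (T k))
    (hD : ∀ k, (D k).IsMinWeight (CSSPhenom.stSyn (toricHGPCode k).HX (T k))
      (CSSPhenom.stCycles (toricHGPCode k).HX (T k)) hammingNorm) :
    (0.0101 : ℝ) < accuracyThreshold (zPhenomFailureFamily (fun k => toricHGPCode k) T D) :=
  lt_of_lt_of_le thresholdValue_five_bounds.1
    (le_accuracyThreshold (toricHGP_z_phenom_isThresholdLowerBound hT D hD)
      ((thresholdValue_le_half 5).trans (by norm_num)))

end Summit.Ventures.QEC.Thresholds
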